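import Summits.BirchSwinnertonDyer.Rank1Residual.F1Sign2.SchneiderLeadingTermFormulaAtTwoSq
import Literature.NumberTheory.EllipticCurves.IwasawaEulerCharRankZeroAssemblyProofs
import HarnessLib

/-!
# TYPING DRAFT (attach seat `bsd-line-att-p4` g7, for the typer `bsd-f1-sign2-ty`): the `Ш`-FREE KERNEL-INDEX formula AT `p = 2` on the C3′
# cell — proposed name `F1Sign2.KerIndexFormulaAtTwoSq`

Crux C3′ `BSDOfMainConjectureRankOneAtTwo` (stmt-BirchSwinnertonDyer-23008), line `birth` v5 → v7 PROPOSAL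
(`Lines/birth_v7_kerindex_proposal_att_p4g7.lean`). BODY = the type of the v7 stub `stub_kerIndexAtTwo` VERBATIM = the right-hand side of the
kernel theorem `Summit.BirchSwinnertonDyer.BirchSwinnertonDyer.Theorems.AlignedTransportAtTwoEulerCharAtTwoAssemblyDivisible.schneiderLeadingTermFormulaAtTwoSqAt_iff_kerIndexAt_of_prop414`
(p636658) prefixed by its cell hypotheses, so that after filing a v8 can register `stub_kerIndexAtTwo : F1Sign2.KerIndexFormulaAtTwoSq` BY NAME.

WHAT IT SAYS. For `W/ℚ` globally minimal, good ordinary at `2`, with `E(ℚ)[2] = 0` and `2 ∤ #E(ℚ)_tors` (= the cell binder «no rational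
`2`-torsion abscissa»), every cyclotomic datum `(κ, γ)`, every Pontryagin-dual datum `D` (strict at `∞`) with `X = D.X` finitely generated and
`Λ`-torsion, THE canonical `2`-adic height `Dh` (`IsCanonicalSq`) with `Reg₂(Dh) ≠ 0`, `Ш(E/ℚ)(2)` finite, and EVERY choice of additive
identifications `e : Sel_∞^{Γ_ℚ} ≃ Sel_∞^γ`, `e₀ : Sel_{2^∞}(E/ℚ) ≃ Sel_{2^∞}(E/ℚ_0)` and of an injection `κ : M ↪ Sel_{2^∞}(E/ℚ)` whose cokernel has the
order of `Ш(E/ℚ)(2)` (canonically: identity on classes, restriction, the `2^∞` Kummer map on `E(ℚ) ⊗ ℚ₂/ℤ₂` — kernel theorems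
`exists_invariantsZero_addEquiv`, `exists_selmerLayerZero_addEquiv`, `exists_kummerToSelmer`, `exists_canonical_derivedKummerMap`): the derived
Kummer map `θ = φ_{Sel} ∘ e ∘ s₀ ∘ e₀ ∘ κ : M → H¹(Γ, Sel_{2^∞}(E/ℚ_∞))` has finite kernel, trivial cokernel, and
`#ker θ · #(A₀/Sel₀) · (log₂ γ_cyc)^{rank E(ℚ)} = u · Reg₂(Dh) · 2^{v₂(∏_v c_v)} · #Ẽ(𝔽₂)(2)²` for some `u ∈ ℤ₂ˣ`
(`A₀/Sel₀` = Greenberg's `ker g₀`, tree `WeierstrassCurve.KerG κ 0`). EQUIVALENT, per cell curve and modulo Greenberg Prop. 4.14 / Hachimori–Matsuno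
at `2` (PRINT), to `SchneiderLeadingTermFormulaAtTwoSqAt W` (p636658); its two halves in print at odd `p`: Greenberg LNM 1716 Lemmas 4.4/4.7 (the
index `#(A₀/Sel₀)` against the local Euler factors) and Perrin-Riou 1992 §3.4 / Schneider 1985 (the derived/Bockstein pairing is the canonical height).
NOT in print at `2` over `ℚ`; open cell obligation, NOT a Literature fact; `@[conjecture]`; nothing asserted; net Literature debt 0.

This draft ELABORATES (rc 0, 0 sorry). The typer may re-home the docstring and trim imports.
-/

set_option autoImplicit false

noncomputable section

open scoped Classical

open WeierstrassCurve Literature.NumberTheory.EllipticCurves Literature.NumberTheory.EllipticCurves.Greenberg1999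
  Literature.NumberTheory.EllipticCurves.IwasawaAlgebra Literature.NumberTheory.EllipticCurves.IwasawaDual

namespace Summit.BirchSwinnertonDyer.Rank1Residual.F1Sign2

/-- **`KerIndexFormulaAtTwoSq` (OPEN at `2`; DRAFT for the typer)** — the `Ш`-free kernel-index form of the `Γ`-Euler-characteristic / Schneider
leading-term formula at `p = 2` on the C3′ cell: for `W/ℚ` globally minimal, `IsOrdinaryAt W 2`, `E(ℚ)[2] = 0`, `2 ∤ #E(ℚ)_tors`, every cyclotomic
datum, every finitely generated `Λ`-torsion strict-at-`∞` dual `D`, THE canonical `Σ²` height `Dh` with `Reg₂(Dh) ≠ 0`, `Ш(E/ℚ)(2)` finite, and every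
`e`, `e₀`, `κ : M ↪ Sel_{2^∞}(E/ℚ)` (cokernel of order `#Ш(2)`): the derived Kummer map `θ = φ_{Sel} ∘ e ∘ s₀ ∘ e₀ ∘ κ` has finite kernel, trivial
cokernel, and `#ker θ · #(A₀/Sel₀) · (log₂5)^{rank E(ℚ)} = u · Reg₂(Dh) · 2^{v₂(∏c_v)} · #Ẽ(𝔽₂)(2)²`, `u ∈ ℤ₂ˣ`. Equivalent per cell curve, modulo
Greenberg Prop. 4.14 at `2`, to `SchneiderLeadingTermFormulaAtTwoSqAt W` (kernel theorem
`…AlignedTransportAtTwoEulerCharAtTwoAssemblyDivisible.schneiderLeadingTermFormulaAtTwoSqAt_iff_kerIndexAt_of_prop414`, p636658). PRINTED for odd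
`p` only, in two halves (Greenberg LNM 1716 Lemmas 4.4/4.7; Perrin-Riou 1992 §3.4 / Schneider 1985); nothing asserted.
[cite: GreenbergLNM1716, §4 Lemmas 4.4–4.7 (printed; the p = 2 positive-rank text is ours)] [cite: PerrinRiou1992, §3.4 (p odd)]
[cite: Schneider1985, Thm. 2′ (p odd)] [cite: CoatesSchneiderSujatha2003, p. 204 (Case 2)] -/
@[conjecture] def KerIndexFormulaAtTwoSq : Prop :=
  ∀ (W : WeierstrassCurve ℚ) [W.IsElliptic] [W.IsGloballyMinimal],
    IsOrdinaryAt W 2 → (∀ P : W.toAffine.Point, 2 • P = 0 → P = 0) → ¬ 2 ∣ W.torsionOrder →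
    ∀ (κ : ZpExtension ℚ 2) (γ : Field.absoluteGaloisGroup ℚ),
      κ.IsCyclotomic → κ.IsTopGenerator γ → IsCyclotomicVariable 2 γ →
    ∀ (D : W.SelmerDualData κ γ) [Module.Finite (IwasawaAlgebra 2) D.X], D.IsTorsion →
    ∀ (Dh : PAdicHeightData W 2), Dh.IsCanonicalSq →
      SchneiderConjecture Dh → Finite (AddCommGroup.primaryComponent W.sha 2) →
    ∀ (e : ↥(W.selmerInfty κ ⊓ W.layerInvariants κ 0) ≃+ ↥(endInvariants (W.conjSelmerInfty κ γ - 1)))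
      (e₀ : ↥(W.selmerGroupPInfty 2) ≃+ ↥(W.selmerLayer κ 0))
      (M : Type) [AddCommGroup M] (kS : M →+ ↥(W.selmerGroupPInfty 2)), Function.Injective kS →
      Nat.card (↥(W.selmerGroupPInfty 2) ⧸ kS.range) = Nat.card (AddCommGroup.primaryComponent W.sha 2) →
    ∀ (θ : M →+ EndCoinvariants (W.conjSelmerInfty κ γ - 1)),
      θ = (W.selmerInftyEulerMap κ γ).comp
        (((e : ↥(W.selmerInfty κ ⊓ W.layerInvariants κ 0) →+ ↥(Literature.NumberTheory.EllipticCurves.IwasawaDual.endInvariants (W.conjSelmerInfty κ γ - 1))).comp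
          (W.sMap κ 0)).comp ((e₀ : ↥(W.selmerGroupPInfty 2) →+ ↥(W.selmerLayer κ 0)).comp kS)) →
      Finite θ.ker ∧ Nat.card (EndCoinvariants (W.conjSelmerInfty κ γ - 1) ⧸ θ.range) = 1 ∧
      ∃ u : ℤ_[2]ˣ,
        (Nat.card θ.ker : ℚ_[2]) * Nat.card (W.KerG κ 0) * padicLog 2 (cyclotomicGenerator 2) ^ W.mordellWeilRank =
          ((u : ℤ_[2]) : ℚ_[2]) * padicRegulator Dh * (2 : ℚ_[2]) ^ (padicValNat 2 W.tamagawaProduct) *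
            (Nat.card (AddCommGroup.primaryComponent
              ((integralModelInt W).map (Int.castRingHom (ZMod 2))).toAffine.Point 2) : ℚ_[2]) ^ 2

end Summit.BirchSwinnertonDyer.Rank1Residual.F1Sign2

end
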